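import Literature.NumberTheory.GaloisCohomology.Howard2004.SelmerTriples
import Mathlib.Algebra.Module.Torsion.Basic
import HarnessLib

/-!
# Howard 2004, Remark 1.2.4: the «ring change» view of `Quot(T)` and the order on `(F, Σ(F))`

Tranche 3 of (W9)-A (`Howard2004/SelmerTriples.lean`), the two LEAD couplings (L1)/(L2) of the
cell `pub/bsd-print-x9` (x9-p1 LEAD, 2026-08-28): Howard, Remark 1.2.4 [arXiv:1202.6340 Rem. 2.2.4,
p. 7 L13–27] lists the functorialities of `KS(T, F, 𝓛)` — (ii) «if `H¹_F(K_v,T) ⊂ H¹_{F′}(K_v,T)`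
at every place `v` then there is a map `KS(T,F,𝓛) → KS(T,F′,𝓛)`», (iii) «if `R → R′` is a ring
homomorphism then there is a map `KS(T,F,𝓛) ⊗_R R′ → KS(T ⊗_R R′, F ⊗_R R′, 𝓛)` …
`Σ(F ⊗_R R′) = Σ(F)`».  This file supplies the two VIEWS these maps are built on (the maps
themselves are the LEAD lineage's theorems): (L1) an object `T/IT` of `Quot(T)` (a presentation
`IsQuotientBy ρ I ρI π`) IS an object of `Mod_{R/I, K}` — the `R/I`-module structure
`IsQuotientBy.moduleQuotient` (a reducible `def`, not an instance, like V2's `moduleH1`) under which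
the action is `R/I`-linear; (L2) the order `(F, Σ) ≤ (F′, Σ′)` on Howard Selmer structures
(`F ≤ F′` placewise AND `Σ ⊆ Σ′`, the enlargement allowed by (iii)), monotone on Selmer modules.
Definitions with bodies and proved lemmas only; no named fact, no `sorry`, no instance.
-/

set_option autoImplicit false

noncomputable section

open Function NumberField IsDedekindDomain Field
open scoped NumberField Classical

namespace Literature.NumberTheory.GaloisCohomology.Howard2004

open Literature.NumberTheory.GaloisRepresentations
open Literature.NumberTheory.GaloisRepresentations.DiscreteGaloisModule

section RingChange

variable {K : Type} [Field K] {M : Type} [AddCommGroup M] [TopologicalSpace M]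
  [DiscreteTopology M] {R : Type} [CommRing R] [Module R M]
  {N : Type} [AddCommGroup N] [TopologicalSpace N] [DiscreteTopology N] [Module R N]
  {ρ : DiscreteGaloisModule K M} {I : Ideal R} {ρI : DiscreteGaloisModule K N} {π : M →ₗ[R] N}

namespace IsQuotientBy

/-- `I` kills `T/IT`. [cite: Howard2004HeegnerKolyvagin, Def. 1.1.3 and Rem. 1.2.4 (iii) (arXiv p. 5 L93–99, p. 7 L19–27)] -/
theorem smul_eq_zero_of_mem (h : IsQuotientBy ρ I ρI π) {r : R} (hr : r ∈ I) (x : N) :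
    r • x = 0 := by
  obtain ⟨m, rfl⟩ := h.surjective x
  have hm : r • m ∈ LinearMap.ker π := by
    rw [h.ker_eq]
    exact Submodule.smul_mem_smul hr Submodule.mem_top
  rw [← map_smul]
  exact LinearMap.mem_ker.mp hm

/-- `T/IT` is `I`-torsion. [cite: Howard2004HeegnerKolyvagin, Def. 1.1.3 (arXiv p. 5, L93–99)] -/
theorem isTorsionBySet (h : IsQuotientBy ρ I ρI π) : Module.IsTorsionBySet R N I :=
  fun x r => h.smul_eq_zero_of_mem r.2 x

/-- **(L1) The «ring change» view**: `T/IT` as an `R/I`-module (Howard Rem. 1.2.4 (iii): an object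
of `Mod_{R,K}` killed by `I` is an object of `Mod_{R/I,K}`; e.g. `T_q = 𝐓/q_m𝐓` over `Λ/(q_m)`).
A reducible `def`, to be opened with `letI` (no instance is declared).
[cite: Howard2004HeegnerKolyvagin, Rem. 1.2.4 (iii) (arXiv Rem. 2.2.4, p. 7, L19–27)] -/
@[reducible] def moduleQuotient (h : IsQuotientBy ρ I ρI π) : Module (R ⧸ I) N :=
  h.isTorsionBySet.module

/-- The `R/I`-action is the `R`-action: `[r] • x = r • x`. [cite: Howard2004HeegnerKolyvagin, Rem. 1.2.4 (iii) (arXiv p. 7, L19–27)] -/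
theorem mk_smul (h : IsQuotientBy ρ I ρI π) (r : R) (x : N) :
    letI := h.moduleQuotient
    Ideal.Quotient.mk I r • x = r • x := by
  letI := h.moduleQuotient
  exact h.isTorsionBySet.mk_smul r x

/-- Under the ring-change view the Galois action on `T/IT` is `R/I`-linear (it is `R`-linear).
[cite: Howard2004HeegnerKolyvagin, Rem. 1.2.4 (iii) (arXiv p. 7, L19–27)] -/
theorem isScalarLinear_quotient (h : IsQuotientBy ρ I ρI π) (hρI : ρI.IsScalarLinear R) :
    letI := h.moduleQuotient
    ρI.IsScalarLinear (R ⧸ I) := by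
  letI := h.moduleQuotient
  intro σ r x
  obtain ⟨r, rfl⟩ := Ideal.Quotient.mk_surjective r
  rw [h.mk_smul, h.mk_smul, hρI σ r x]

/-- `R`-linearity of `T` descends to `T/IT` along the presentation. [cite: Howard2004HeegnerKolyvagin, Def. 1.1.3 (arXiv p. 5, L93–99)] -/
theorem isScalarLinear (h : IsQuotientBy ρ I ρI π) (hρ : ρ.IsScalarLinear R) :
    ρI.IsScalarLinear R := by
  intro σ r x
  obtain ⟨m, rfl⟩ := h.surjective x
  rw [← map_smul, ← h.equivariant, ← h.equivariant, hρ σ r m, map_smul]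

end IsQuotientBy

end RingChange

section Order

variable {K : Type} [Field K] [NumberField K] {M : Type} [AddCommGroup M] [TopologicalSpace M]
  [DiscreteTopology M] {ρ : DiscreteGaloisModule K M}

/-- **(L2) The order on Howard Selmer structures `(F, Σ(F))`**: `(F, Σ) ≤ (F′, Σ′)` iff
`H¹_F(K_v, T) ⊂ H¹_{F′}(K_v, T)` at every place AND `Σ ⊆ Σ′` («natural partial ordering … `F ≤ F′`
iff `H¹_F(K_v,T) ⊂ H¹_{F′}(K_v,T)` for every place», Def. 1.1.10; the enlargement of `Σ` is the one
of Rem. 1.2.4 (ii)/(iii)). [cite: Howard2004HeegnerKolyvagin, Def. 1.1.10 and Rem. 1.2.4 (arXiv p. 6 L25–28, p. 7 L13–27)] -/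
def SelmerDataLE (𝓕 : SelmerStructure ρ) (S : Finset (Place K)) (𝓕' : SelmerStructure ρ)
    (S' : Finset (Place K)) : Prop :=
  𝓕 ≤ 𝓕' ∧ S ⊆ S'

/-- Reflexivity. [cite: Howard2004HeegnerKolyvagin, Def. 1.1.10 (arXiv p. 6, L25–28)] -/
theorem SelmerDataLE.refl (𝓕 : SelmerStructure ρ) (S : Finset (Place K)) : SelmerDataLE 𝓕 S 𝓕 S :=
  ⟨le_rfl, subset_rfl⟩

/-- Transitivity. [cite: Howard2004HeegnerKolyvagin, Def. 1.1.10 (arXiv p. 6, L25–28)] -/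
theorem SelmerDataLE.trans {𝓕 𝓕' 𝓕'' : SelmerStructure ρ} {S S' S'' : Finset (Place K)}
    (h : SelmerDataLE 𝓕 S 𝓕' S') (h' : SelmerDataLE 𝓕' S' 𝓕'' S'') : SelmerDataLE 𝓕 S 𝓕'' S'' :=
  ⟨h.1.trans h'.1, h.2.trans h'.2⟩

/-- «Clearly if `F ≤ F′` we have `H¹_F(K,T) ⊂ H¹_{F′}(K,T)`.» [cite: Howard2004HeegnerKolyvagin, Def. 1.1.10 (arXiv p. 6, L27–28)] -/
theorem SelmerDataLE.selmerModule_le {𝓕 𝓕' : SelmerStructure ρ} {S S' : Finset (Place K)}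
    (h : SelmerDataLE 𝓕 S 𝓕' S') : selmerModule 𝓕 ≤ selmerModule 𝓕' :=
  selmerModule_mono h.1

/-- A Howard Selmer structure for `Σ` is one for any larger finite `Σ′` whose extra places carry the
finite (unramified) condition — i.e. `Σ(F)` may be enlarged (Rem. 1.2.4 (iii): `Σ(F ⊗ R′) = Σ(F)`
is a choice, any finite superset works). [cite: Howard2004HeegnerKolyvagin, Def. 1.1.10 and Rem. 1.2.4 (arXiv p. 6 L10–24, p. 7 L19–27)] -/
theorem IsHowardSelmerStructure.mono {p : ℕ} {𝓕 : SelmerStructure ρ} {S S' : Finset (Place K)}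
    (h : IsHowardSelmerStructure p 𝓕 S) (hS : S ⊆ S')
    (hS' : ∀ v : HeightOneSpectrum (𝓞 K), (Sum.inr v : Place K) ∉ S' →
      𝓕 (Sum.inr v) = unramifiedSubgroup (GaloisRep.toLocal v ρ) 1) :
    IsHowardSelmerStructure p 𝓕 S' where
  isUnramifiedOutside := ⟨fun w => hS (h.isUnramifiedOutside.1 w), hS'⟩
  mem_of_dvd v hv := hS (h.mem_of_dvd v hv)
  mem_of_ramified v hv := hS (h.mem_of_ramified v hv)

end Order

end Literature.NumberTheory.GaloisCohomology.Howard2004
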